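import Literature.NumberTheory.Sieve.FractionPhases
import Literature.NumberTheory.Sieve.SmoothCompletionOfSums
import HarnessLib

/-!
# Complete sums of fraction phases to a prime modulus (Polymath 8a, Proposition 4.6 / (4.8), (4.9))

Topic `Literature/NumberTheory/Sieve`, grouping namespace `Polymath8a`; a support file for the named
fact `Literature.NumberTheory.Sieve.mpz_of_lt` (**parity.S29**, `ParityWave0.lean`), continuing
`FractionPhases.lean` (the phases `e_d(c/m)`, Lemma 4.4, Lemma 4.8).  Source: D. H. J. Polymath,
*New equidistribution estimates of Zhang type*, Algebra & Number Theory 8:9 (2014) 2067–2199 =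
arXiv:1402.0811, §4.2–4.3: the proof of **Proposition 4.6** (Ramanujan–Weil bounds) factors a complete
sum `∑_{n ∈ ℤ/qℤ} e_q(f(n))`, `q` squarefree, over the primes `p ∣ q` (Lemma 4.4) and bounds each local
sum by `p`, `O(1)` or `O(√p)` according as `p ∣ f'`, `p ∣ f''` but `p ∤ f'`, or neither ((4.12)–(4.14)),
the last case being Weil's bound (Lemma 4.2), of which "(4.8) [Kloosterman sums] and (4.9) are almost
the only two cases needed".  For the phases that actually occur in the Type I/II estimates — after
completion of sums (Lemma 4.9), products of one-pole phases `e_{d_i}(c_i/(n + l_i))` twisted by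
`e_q(hn)` (Corollary 4.16, Proposition 5.10) — the local sums at a prime `p` are, by cases:

* one pole + twist: `∑_{n mod p} e_p(c/(n+l)) e_p(hn) = e_p(−hl) S(h, c; p)` is a Kloosterman sum
  (`sum_range_eFrac_add_mul_twist`), hence (`norm_sum_range_eFrac_add_mul_twist_le`) of modulus
  `≤ 2√p` unless `p ∣ c` and `p ∣ h` (Weil's bound (4.8), the tree's PROVED
  `weil_kloosterman_bound_prime_holds`; the sub-cases `p ∣ h` or `p ∣ c` are Ramanujan sums), and
  `= p − 1` in the excluded case ("`p ∣ f'`");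
* two poles merging modulo `p` (`l₁ ≡ l₂`): `e_p(c₁/(n+l)) e_p(c₂/(n+l)) = e_p((c₁+c₂)/(n+l))`
  (`eFrac_mul_eFrac_same`), reducing to the previous case;
* a vanishing numerator: `e_p(0/(n+l)) = 1_{n ≢ −l}` only deletes one term (`eFrac_zero_left`,
  `norm_sum_erase_le`-type bookkeeping: `norm_sum_range_indicator_mul_le`);
* two genuine poles, no twist: by the Möbius change of variables `w = (n + l₂)/(n + l₁)`,
  `∑_{n mod p} e_p(c₁/(n+l₁) + c₂/(n+l₂)) = e_p((c₂−c₁)/t) (S(c₁/t, −c₂/t; p) − e_p((c₁−c₂)/t))`,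
  `t = l₂ − l₁ ≢ 0` (`sum_eFrac_mul_eFrac_eq_kloosterman`), hence of modulus `≤ 2√p + 1`
  (`norm_sum_range_eFrac_mul_eFrac_le_of_prime`) — a case of (4.9)/(4.14) which needs only (4.8);
* two genuine poles AND a twist `h ≢ 0 (p)`: a rational phase with three poles, the genuinely new case
  of Lemma 4.2 (Weil 1948, Perelmuter 1969), which is NOT proved here and NOT in the tree; downstream
  assemblies (Corollary 4.16) take it as an explicit hypothesis.

Everything in this file is PROVED (theorems only; no definitions, no named facts).

## References

* D. H. J. Polymath, *New equidistribution estimates of Zhang type*, Algebra & Number Theory 8:9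
  (2014) 2067–2199, arXiv:1402.0811: Lemma 4.2, (4.8), (4.9), Proposition 4.6 and its proof
  ((4.12)–(4.14)), Example 4.7. [cite: Polymath8a2014, Proposition 4.6, proof]
* A. Weil, *On some exponential sums*, Proc. Nat. Acad. Sci. USA 34 (1948) 204–207 (the tree's
  `weil_kloosterman_bound_prime`, PROVED in `KloostermanWeilPrimeProofs.lean`).
-/

noncomputable section

open Finset Real
open scoped ComplexConjugate FourierTransform

namespace Literature.NumberTheory.Sieve

namespace Polymath8a

open Literature.NumberTheory.LFunctions (kloostermanSum sum_zmod_eq_sum_range kloostermanSum_comm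
  weil_kloosterman_bound_prime_holds)
open Literature.NumberTheory.LFunctions.MatomakiMerikoski (kloostermanSum_zero_left_eq_ramanujanSum
  norm_ramanujanSum_le_gcd)

/-! ### Elementary identities for `e_d(c/m)` -/

section General

variable {d : ℕ} [NeZero d]

/-- **Merging poles**: `e_d(c₁/m) e_d(c₂/m) = e_d((c₁ + c₂)/m)`. [folklore] -/
theorem eFrac_mul_eFrac_same (c₁ c₂ m : ℤ) : eFrac d c₁ m * eFrac d c₂ m = eFrac d (c₁ + c₂) m := by
  by_cases h : IsUnit (m : ZMod d)
  · rw [eFrac_of_isUnit h, eFrac_of_isUnit h, eFrac_of_isUnit h, ← AddChar.map_add_eq_mul]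
    push_cast
    ring_nf
  · rw [eFrac_of_not_isUnit h, eFrac_of_not_isUnit h, eFrac_of_not_isUnit h, zero_mul]

/-- **A vanishing numerator leaves the indicator of the non-poles**: `e_d(0/m) = 1_{(m,d)=1}`.
[cite: Polymath8a2014, §4.1 (Example 4.1)] -/
theorem eFrac_zero_left (m : ℤ) : eFrac d 0 m = if IsUnit (m : ZMod d) then 1 else 0 := by
  by_cases h : IsUnit (m : ZMod d)
  · rw [eFrac_of_isUnit h, if_pos h]
    push_cast
    rw [zero_mul, AddChar.map_zero_eq_one]
  · rw [eFrac_of_not_isUnit h, if_neg h]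

/-- If `d ∣ c` then `e_d(c/m) = 1_{(m,d)=1}`. [folklore] -/
theorem eFrac_of_dvd_left {c : ℤ} (hc : (d : ℤ) ∣ c) (m : ℤ) :
    eFrac d c m = if IsUnit (m : ZMod d) then 1 else 0 := by
  have h0 : (c : ZMod d) = ((0 : ℤ) : ZMod d) := by
    rw [Int.cast_zero]; exact (ZMod.intCast_zmod_eq_zero_iff_dvd c d).mpr hc
  rw [eFrac_congr_left h0, eFrac_zero_left]

/-- The additive twist `e(nh/d)` of completion of sums (Lemma 4.9), as a value of the standard
additive character of `ℤ/dℤ`. [folklore] -/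
theorem fourierChar_mul_div_eq_stdAddChar (n h : ℤ) :
    (𝐞 ((n : ℝ) * h / d) : ℂ) = ZMod.stdAddChar ((n * h : ℤ) : ZMod d) := by
  rw [ZMod.stdAddChar_coe, Real.fourierChar_apply]
  congr 1
  push_cast
  ring

/-- Deleting the terms where an indicator vanishes costs at most their number: if `|F| ≤ 1` then
`|∑_{n ∈ s} 1_{P(n)} F(n)| ≤ |∑_{n ∈ s} F(n)| + #{n ∈ s : ¬P(n)}`. [folklore] -/
theorem norm_sum_indicator_mul_le {ι : Type*} (s : Finset ι) (P : ι → Prop) [DecidablePred P]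
    (F : ι → ℂ) (hF : ∀ i ∈ s, ‖F i‖ ≤ 1) :
    ‖∑ i ∈ s, (if P i then 1 else 0) * F i‖ ≤ ‖∑ i ∈ s, F i‖ + (s.filter fun i => ¬ P i).card := by
  have hsplit : ∑ i ∈ s, (if P i then 1 else 0) * F i = ∑ i ∈ s, F i - ∑ i ∈ s.filter (fun i => ¬ P i), F i := by
    rw [Finset.sum_filter, eq_sub_iff_add_eq, ← Finset.sum_add_distrib]
    refine Finset.sum_congr rfl fun i _ => ?_
    split_ifs <;> simp
  rw [hsplit]
  refine (norm_sub_le _ _).trans (add_le_add le_rfl ?_)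
  refine (norm_sum_le _ _).trans ?_
  calc ∑ i ∈ s.filter (fun i => ¬ P i), ‖F i‖ ≤ ∑ i ∈ s.filter (fun i => ¬ P i), (1 : ℝ) :=
        Finset.sum_le_sum fun i hi => hF i (Finset.mem_of_mem_filter i hi)
    _ = _ := by simp

end General

/-! ### One pole and a twist: Kloosterman sums -/

section Prime

variable {p : ℕ} [hp : Fact p.Prime]

/-- Exactly one residue `0 ≤ n < p` has `n + l ≡ 0 (mod p)`. [folklore] -/
theorem card_filter_add_eq_zero (l : ℤ) :
    ((Finset.range p).filter fun n : ℕ => ¬ IsUnit (((n : ℤ) + l : ℤ) : ZMod p)).card = 1 := by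
  classical
  haveI : NeZero p := ⟨hp.out.ne_zero⟩
  have h := sum_range_ite_dvd_sub hp.out.pos (-l) (fun _ => (1 : ℕ))
  rw [Finset.card_eq_sum_ones, ← Finset.sum_filter] at *
  convert h using 2
  ext n
  simp only [Finset.mem_filter, Finset.mem_range, and_congr_right_iff]
  intro _
  rw [isUnit_iff_ne_zero, not_not, sub_neg_eq_add, ZMod.intCast_zmod_eq_zero_iff_dvd]


/-- **One pole and a twist is a Kloosterman sum**:
`∑_{0 ≤ n < p} e_p(c/(n + l)) e(hn/p) = e_p(−hl) S(h, c; p)` (`S` the tree's `kloostermanSum`; for any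
modulus in fact, but only the prime case is needed). [cite: Polymath8a2014, (4.8) and Example 4.7] -/
theorem sum_range_eFrac_add_mul_twist (c l h : ℤ) :
    ∑ n ∈ Finset.range p, eFrac p c (n + l) * (ZMod.stdAddChar ((n * h : ℤ) : ZMod p) : ℂ) =
      ZMod.stdAddChar ((-(l * h) : ℤ) : ZMod p) * kloostermanSum p (h : ZMod p) (c : ZMod p) := by
  classical
  -- shift `n ↦ n - l`
  have hper : ∀ m n : ℤ, (fun m : ℤ => eFrac p c (m + l) * (ZMod.stdAddChar ((m * h : ℤ) : ZMod p) : ℂ))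
      (m + p * n) = (fun m : ℤ => eFrac p c (m + l) * (ZMod.stdAddChar ((m * h : ℤ) : ZMod p) : ℂ)) m := by
    intro m n
    simp only
    rw [show m + p * n + l = (m + l) + p * n by ring, eFrac_add_mul_self]
    congr 2
    push_cast
    rw [ZMod.natCast_self]
    ring
  have hshift := sum_range_comp_add_of_periodic (d := p)
    (F := fun m : ℤ => eFrac p c (m + l) * (ZMod.stdAddChar ((m * h : ℤ) : ZMod p) : ℂ)) hper (-l)
  rw [← hshift]
  -- now the summand is `e_p(c/n) e(h(n - l)/p)`
  unfold Literature.NumberTheory.LFunctions.kloostermanSum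
  rw [sum_zmod_eq_sum_range, Finset.mul_sum]
  refine Finset.sum_congr rfl fun n _ => ?_
  rw [show (n : ℤ) + -l + l = n by ring]
  by_cases hu : IsUnit ((n : ℕ) : ZMod p)
  · have hu' : IsUnit (((n : ℕ) : ℤ) : ZMod p) := by rwa [Int.cast_natCast]
    rw [eFrac_of_isUnit hu', if_pos hu, ← AddChar.map_add_eq_mul, ← AddChar.map_add_eq_mul]
    congr 1
    push_cast
    ring
  · have hu' : ¬ IsUnit (((n : ℕ) : ℤ) : ZMod p) := by rwa [Int.cast_natCast]
    rw [eFrac_of_not_isUnit hu', if_neg hu, zero_mul, mul_zero]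

/-- The same complete sum with the twist written as `e(nh/p)`. [cite: Polymath8a2014, (4.8)] -/
theorem sum_range_eFrac_add_mul_fourierChar (c l h : ℤ) :
    ∑ n ∈ Finset.range p, eFrac p c (n + l) * (𝐞 ((n : ℝ) * h / p) : ℂ) =
      ZMod.stdAddChar ((-(l * h) : ℤ) : ZMod p) * kloostermanSum p (h : ZMod p) (c : ZMod p) := by
  rw [← sum_range_eFrac_add_mul_twist c l h]
  refine Finset.sum_congr rfl fun n _ => ?_
  rw [← Int.cast_natCast (R := ℝ) n, fourierChar_mul_div_eq_stdAddChar (d := p)]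

/-- **The local bound for one pole and a twist** (the cases (4.12)–(4.14) of the proof of
Proposition 4.6 for `f(n) = c/(n+l) + hn`): unless `p ∣ c` and `p ∣ h` ("`p ∣ f'`"),
`|∑_{0 ≤ n < p} e_p(c/(n + l)) e(hn/p)| ≤ 2√p` — Weil's bound (4.8) when `p ∤ ch`, a Ramanujan sum
(of modulus `1`) when exactly one of `c, h` vanishes modulo `p`.
[cite: Polymath8a2014, Proposition 4.6, proof, and (4.8)] -/
theorem norm_sum_range_eFrac_add_mul_twist_le (c l h : ℤ) (hch : ¬ ((p : ℤ) ∣ c ∧ (p : ℤ) ∣ h)) :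
    ‖∑ n ∈ Finset.range p, eFrac p c (n + l) * (ZMod.stdAddChar ((n * h : ℤ) : ZMod p) : ℂ)‖ ≤
      2 * Real.sqrt p := by
  haveI : NeZero p := ⟨hp.out.ne_zero⟩
  rw [sum_range_eFrac_add_mul_twist, norm_mul, norm_stdAddChar, one_mul]
  have hsqrt : (1 : ℝ) ≤ 2 * Real.sqrt p := by
    have : (1 : ℝ) ≤ Real.sqrt p := by
      rw [Real.one_le_sqrt]; exact_mod_cast hp.out.one_lt.le
    linarith
  have hgcd : ∀ {a : ℤ}, ¬ (p : ℤ) ∣ a → Int.gcd a p = 1 := fun {a} ha => by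
    rw [Int.gcd_eq_natAbs, Int.natAbs_natCast]
    exact Nat.Coprime.symm ((Nat.Prime.coprime_iff_not_dvd hp.out).mpr
      fun h' => ha (Int.natCast_dvd.mpr h'))
  by_cases hc : (p : ℤ) ∣ c
  · -- then `p ∤ h`: a Ramanujan sum in `h`
    have hh : ¬ (p : ℤ) ∣ h := fun hh => hch ⟨hc, hh⟩
    rw [(ZMod.intCast_zmod_eq_zero_iff_dvd c p).mpr hc, kloostermanSum_comm,
      kloostermanSum_zero_left_eq_ramanujanSum]
    refine (norm_ramanujanSum_le_gcd p _).trans (le_trans ?_ hsqrt)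
    rw [ZMod.val_intCast, Int.gcd_emod, hgcd hh, Nat.cast_one]
  · by_cases hh : (p : ℤ) ∣ h
    · rw [(ZMod.intCast_zmod_eq_zero_iff_dvd h p).mpr hh, kloostermanSum_zero_left_eq_ramanujanSum]
      refine (norm_ramanujanSum_le_gcd p _).trans (le_trans ?_ hsqrt)
      rw [ZMod.val_intCast, Int.gcd_emod, hgcd hc, Nat.cast_one]
    · have hc0 : (c : ZMod p) ≠ 0 := fun h0 => hc ((ZMod.intCast_zmod_eq_zero_iff_dvd c p).mp h0)
      have hh0 : (h : ZMod p) ≠ 0 := fun h0 => hh ((ZMod.intCast_zmod_eq_zero_iff_dvd h p).mp h0)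
      exact weil_kloosterman_bound_prime_holds p _ _ hh0 hc0

/-- The excluded case `p ∣ c`, `p ∣ h` ("`p ∣ f'`", trivial bound (4.12)): the sum is `p − 1`.
[cite: Polymath8a2014, Proposition 4.6, proof, (4.12)] -/
theorem sum_range_eFrac_add_mul_twist_of_dvd {c h : ℤ} (hc : (p : ℤ) ∣ c) (hh : (p : ℤ) ∣ h) (l : ℤ) :
    ∑ n ∈ Finset.range p, eFrac p c (n + l) * (ZMod.stdAddChar ((n * h : ℤ) : ZMod p) : ℂ) = p - 1 := by
  classical
  haveI : NeZero p := ⟨hp.out.ne_zero⟩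
  have hterm : ∀ n : ℕ, eFrac p c (n + l) * (ZMod.stdAddChar ((n * h : ℤ) : ZMod p) : ℂ) =
      if IsUnit ((n + l : ℤ) : ZMod p) then 1 else 0 := by
    intro n
    obtain ⟨k, rfl⟩ := hh
    rw [eFrac_of_dvd_left hc, show ((n : ℤ) * (p * k) : ℤ) = p * (n * k) by ring]
    push_cast
    rw [ZMod.natCast_self, zero_mul, AddChar.map_zero_eq_one, mul_one]
  simp_rw [hterm]
  -- count the non-poles: all residues but `n ≡ -l`
  rw [Finset.sum_ite, Finset.sum_const_zero, add_zero, Finset.sum_const, nsmul_eq_mul, mul_one]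
  have hcard := Finset.card_filter_add_card_filter_not
    (s := Finset.range p) (fun n : ℕ => IsUnit (((n : ℤ) + l : ℤ) : ZMod p))
  rw [card_filter_add_eq_zero, Finset.card_range] at hcard
  have : ((Finset.range p).filter fun n : ℕ => IsUnit (((n : ℤ) + l : ℤ) : ZMod p)).card = p - 1 := by
    omega
  rw [this, Nat.cast_sub hp.out.one_le, Nat.cast_one]

end Prime

/-! ### Two genuine poles, no twist: a Möbius change of variables to a Kloosterman sum -/

section TwoPoles

variable {p : ℕ} [hp : Fact p.Prime]

/-- The Kloosterman sum without its `w = 1` term, as a sum over `w ∉ {0, 1}`. [folklore] -/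
theorem kloostermanSum_sub_eq_sum_filter (a b : ZMod p) :
    kloostermanSum p a b - ZMod.stdAddChar (a + b) =
      ∑ w ∈ (Finset.univ : Finset (ZMod p)).filter (fun w => w ≠ 0 ∧ w ≠ 1),
        (ZMod.stdAddChar (a * w + b * w⁻¹) : ℂ) := by
  classical
  haveI : NeZero p := ⟨hp.out.ne_zero⟩
  unfold Literature.NumberTheory.LFunctions.kloostermanSum
  rw [sub_eq_iff_eq_add]
  have h1 : (Finset.univ : Finset (ZMod p)).filter (fun w => w ≠ 0) =
      insert (1 : ZMod p) ((Finset.univ : Finset (ZMod p)).filter (fun w => w ≠ 0 ∧ w ≠ 1)) := by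
    ext w
    simp only [Finset.mem_filter, Finset.mem_univ, true_and, Finset.mem_insert]
    constructor
    · intro hw; by_cases hw1 : w = 1
      · exact Or.inl hw1
      · exact Or.inr ⟨hw, hw1⟩
    · rintro (rfl | ⟨hw, -⟩)
      · exact one_ne_zero
      · exact hw
  calc ∑ x : ZMod p, (if IsUnit x then (ZMod.stdAddChar (a * x + b * x⁻¹) : ℂ) else 0)
      = ∑ w ∈ (Finset.univ : Finset (ZMod p)).filter (fun w => w ≠ 0),
          (ZMod.stdAddChar (a * w + b * w⁻¹) : ℂ) := by
        rw [Finset.sum_filter]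
        refine Finset.sum_congr rfl fun w _ => ?_
        simp only [isUnit_iff_ne_zero]
    _ = _ := by
        rw [h1, Finset.sum_insert (by simp)]
        simp only [mul_one, inv_one, add_comm]

/-- **Two genuine poles and no twist are a Kloosterman sum** (the case (4.9)/(4.14) of Proposition 4.6
that needs only Weil's bound (4.8)): on `ℤ/pℤ`, for `t = l₂ − l₁ ≠ 0`,
`∑_{x : x+l₁ ≠ 0, x+l₂ ≠ 0} ψ(c₁/(x+l₁) + c₂/(x+l₂)) = ψ((c₂−c₁)/t) · (S(c₁/t, −c₂/t; p) − ψ(c₁/t − c₂/t))`,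
by the Möbius change of variables `w = (x + l₂)/(x + l₁)`, which maps the non-poles bijectively onto
`w ∉ {0, 1}` and under which `1/(x+l₁) = (w−1)/t`, `1/(x+l₂) = (w−1)/(tw)`.
[cite: Polymath8a2014, Proposition 4.6, proof ((4.14) via Lemma 4.2 / (4.8))] -/
theorem sum_twoPole_eq_kloosterman (c₁ c₂ l₁ l₂ : ZMod p) (ht : l₂ - l₁ ≠ 0) :
    ∑ x : ZMod p, (if x + l₁ ≠ 0 ∧ x + l₂ ≠ 0 then
        (ZMod.stdAddChar (c₁ * (x + l₁)⁻¹ + c₂ * (x + l₂)⁻¹) : ℂ) else 0) =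
      ZMod.stdAddChar ((c₂ - c₁) * (l₂ - l₁)⁻¹) *
        (kloostermanSum p (c₁ * (l₂ - l₁)⁻¹) (-(c₂ * (l₂ - l₁)⁻¹)) -
          ZMod.stdAddChar (c₁ * (l₂ - l₁)⁻¹ + -(c₂ * (l₂ - l₁)⁻¹))) := by
  classical
  rw [kloostermanSum_sub_eq_sum_filter, Finset.mul_sum, ← Finset.sum_filter]
  simp_rw [← AddChar.map_add_eq_mul]
  -- the bijection `x ↦ w = (x + l₂)/(x + l₁)` with inverse `w ↦ (l₂ − w l₁)/(w − 1)`
  refine Finset.sum_bij' (fun x _ => (x + l₂) * (x + l₁)⁻¹) (fun w _ => (l₂ - w * l₁) * (w - 1)⁻¹)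
    ?_ ?_ ?_ ?_ ?_
  · intro x hx
    simp only [Finset.mem_filter, Finset.mem_univ, true_and] at hx ⊢
    obtain ⟨h₁, h₂⟩ := hx
    refine ⟨mul_ne_zero h₂ (inv_ne_zero h₁), fun h => ht ?_⟩
    have : x + l₂ = x + l₁ := by
      have := congrArg (· * (x + l₁)) h
      simpa [inv_mul_cancel_right₀ h₁] using this
    linear_combination this
  · intro w hw
    simp only [Finset.mem_filter, Finset.mem_univ, true_and] at hw ⊢
    obtain ⟨h0, h1⟩ := hw
    have hw1 : w - 1 ≠ 0 := sub_ne_zero.mpr h1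
    have e₁ : (l₂ - w * l₁) * (w - 1)⁻¹ + l₁ = (l₂ - l₁) * (w - 1)⁻¹ := by
      field_simp; ring
    have e₂ : (l₂ - w * l₁) * (w - 1)⁻¹ + l₂ = w * (l₂ - l₁) * (w - 1)⁻¹ := by
      field_simp; ring
    rw [e₁, e₂]
    exact ⟨mul_ne_zero ht (inv_ne_zero hw1), mul_ne_zero (mul_ne_zero h0 ht) (inv_ne_zero hw1)⟩
  · intro x hx
    simp only [Finset.mem_filter, Finset.mem_univ, true_and] at hx
    obtain ⟨h₁, h₂⟩ := hx
    have hne : (x + l₂) * (x + l₁)⁻¹ - 1 ≠ 0 := by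
      rw [sub_ne_zero]
      intro h
      apply ht
      have : x + l₂ = x + l₁ := by
        have := congrArg (· * (x + l₁)) h
        simpa [inv_mul_cancel_right₀ h₁] using this
      linear_combination this
    rw [mul_inv_eq_iff_eq_mul₀ hne]
    field_simp
    ring
  · intro w hw
    simp only [Finset.mem_filter, Finset.mem_univ, true_and] at hw
    obtain ⟨h0, h1⟩ := hw
    have hw1 : w - 1 ≠ 0 := sub_ne_zero.mpr h1
    have e₁ : (l₂ - w * l₁) * (w - 1)⁻¹ + l₁ = (l₂ - l₁) * (w - 1)⁻¹ := by
      field_simp; ring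
    have e₂ : (l₂ - w * l₁) * (w - 1)⁻¹ + l₂ = w * (l₂ - l₁) * (w - 1)⁻¹ := by
      field_simp; ring
    rw [e₁, e₂]
    field_simp
  · intro x hx
    simp only [Finset.mem_filter, Finset.mem_univ, true_and] at hx
    obtain ⟨h₁, h₂⟩ := hx
    congr 1
    field_simp
    ring

/-- The two-pole product of fraction phases at an integer, on `ℤ/pℤ`. [folklore] -/
theorem eFrac_mul_eFrac_eq_ite (c₁ c₂ l₁ l₂ : ℤ) (n : ℕ) :
    eFrac p c₁ (n + l₁) * eFrac p c₂ (n + l₂) =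
      if (n : ZMod p) + (l₁ : ZMod p) ≠ 0 ∧ (n : ZMod p) + (l₂ : ZMod p) ≠ 0 then
        (ZMod.stdAddChar ((c₁ : ZMod p) * ((n : ZMod p) + (l₁ : ZMod p))⁻¹ +
          (c₂ : ZMod p) * ((n : ZMod p) + (l₂ : ZMod p))⁻¹) : ℂ) else 0 := by
  haveI : NeZero p := ⟨hp.out.ne_zero⟩
  have hc₁ : (((n : ℤ) + l₁ : ℤ) : ZMod p) = (n : ZMod p) + (l₁ : ZMod p) := by push_cast; ring
  have hc₂ : (((n : ℤ) + l₂ : ℤ) : ZMod p) = (n : ZMod p) + (l₂ : ZMod p) := by push_cast; ring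
  by_cases h₁ : (n : ZMod p) + (l₁ : ZMod p) ≠ 0
  · by_cases h₂ : (n : ZMod p) + (l₂ : ZMod p) ≠ 0
    · rw [if_pos ⟨h₁, h₂⟩, eFrac_of_isUnit (by rw [hc₁]; exact isUnit_iff_ne_zero.mpr h₁),
        eFrac_of_isUnit (by rw [hc₂]; exact isUnit_iff_ne_zero.mpr h₂), ← AddChar.map_add_eq_mul,
        hc₁, hc₂]
    · rw [if_neg (fun h => h₂ h.2), eFrac_of_not_isUnit (m := n + l₂)
        (by rw [hc₂, isUnit_iff_ne_zero]; exact h₂), mul_zero]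
  · rw [if_neg (fun h => h₁ h.1), eFrac_of_not_isUnit (m := n + l₁)
      (by rw [hc₁, isUnit_iff_ne_zero]; exact h₁), zero_mul]

/-- **The local bound for two genuine poles without twist**: for `p ∤ c₁ c₂` and `l₁ ≢ l₂ (p)`,
`|∑_{0 ≤ n < p} e_p(c₁/(n+l₁)) e_p(c₂/(n+l₂))| ≤ 2√p + 1` (Weil's bound (4.8) after the Möbius change
of variables of `sum_twoPole_eq_kloosterman`; Lemma 4.8 only uses the trivial bound `p` here).
[cite: Polymath8a2014, Proposition 4.6, proof, (4.14)] -/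
theorem norm_sum_range_eFrac_mul_eFrac_le_of_prime {c₁ c₂ l₁ l₂ : ℤ} (hc₁ : ¬ (p : ℤ) ∣ c₁)
    (hc₂ : ¬ (p : ℤ) ∣ c₂) (hl : ¬ (p : ℤ) ∣ l₂ - l₁) :
    ‖∑ n ∈ Finset.range p, eFrac p c₁ (n + l₁) * eFrac p c₂ (n + l₂)‖ ≤ 2 * Real.sqrt p + 1 := by
  classical
  haveI : NeZero p := ⟨hp.out.ne_zero⟩
  have ht : (l₂ : ZMod p) - (l₁ : ZMod p) ≠ 0 := by
    intro h; apply hl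
    rw [← ZMod.intCast_zmod_eq_zero_iff_dvd]; push_cast; exact h
  have hc₁' : (c₁ : ZMod p) ≠ 0 := fun h => hc₁ ((ZMod.intCast_zmod_eq_zero_iff_dvd c₁ p).mp h)
  have hc₂' : (c₂ : ZMod p) ≠ 0 := fun h => hc₂ ((ZMod.intCast_zmod_eq_zero_iff_dvd c₂ p).mp h)
  rw [Finset.sum_congr rfl fun n _ => eFrac_mul_eFrac_eq_ite (p := p) c₁ c₂ l₁ l₂ n,
    ← sum_zmod_eq_sum_range (fun x : ZMod p => if x + (l₁ : ZMod p) ≠ 0 ∧ x + (l₂ : ZMod p) ≠ 0 then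
      (ZMod.stdAddChar ((c₁ : ZMod p) * (x + (l₁ : ZMod p))⁻¹ +
        (c₂ : ZMod p) * (x + (l₂ : ZMod p))⁻¹) : ℂ) else 0),
    sum_twoPole_eq_kloosterman _ _ _ _ ht, norm_mul, norm_stdAddChar, one_mul]
  refine (norm_sub_le _ _).trans (add_le_add ?_ (le_of_eq (norm_stdAddChar _)))
  refine weil_kloosterman_bound_prime_holds p _ _ ?_ ?_
  · exact mul_ne_zero hc₁' (inv_ne_zero ht)
  · exact neg_ne_zero.mpr (mul_ne_zero hc₂' (inv_ne_zero ht))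

end TwoPoles

/-! ### A vanishing numerator next to a one-pole phase -/

section Vanishing

variable {p : ℕ} [hp : Fact p.Prime]

/-- **A vanishing numerator only deletes one term**: if `p ∣ c₁` then
`|∑_{0 ≤ n < p} e_p(c₁/(n+l₁)) e_p(c₂/(n+l₂)) e(hn/p)| ≤ 2√p + 1` unless `p ∣ c₂` and `p ∣ h`
(`e_p(c₁/(n+l₁)) = 1_{n ≢ −l₁}` and the one-pole bound `norm_sum_range_eFrac_add_mul_twist_le`).
[cite: Polymath8a2014, Proposition 4.6, proof] -/
theorem norm_sum_range_eFrac_mul_eFrac_mul_twist_le_of_dvd {c₁ c₂ h : ℤ} (hc₁ : (p : ℤ) ∣ c₁)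
    (hch : ¬ ((p : ℤ) ∣ c₂ ∧ (p : ℤ) ∣ h)) (l₁ l₂ : ℤ) :
    ‖∑ n ∈ Finset.range p, eFrac p c₁ (n + l₁) * eFrac p c₂ (n + l₂) *
        (ZMod.stdAddChar ((n * h : ℤ) : ZMod p) : ℂ)‖ ≤ 2 * Real.sqrt p + 1 := by
  classical
  haveI : NeZero p := ⟨hp.out.ne_zero⟩
  have hre : ∀ n : ℕ, eFrac p c₁ (n + l₁) * eFrac p c₂ (n + l₂) * (ZMod.stdAddChar ((n * h : ℤ) : ZMod p) : ℂ) =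
      (if IsUnit (((n : ℤ) + l₁ : ℤ) : ZMod p) then 1 else 0) *
        (eFrac p c₂ (n + l₂) * (ZMod.stdAddChar ((n * h : ℤ) : ZMod p) : ℂ)) := by
    intro n; rw [eFrac_of_dvd_left hc₁, mul_assoc]
  simp_rw [hre]
  refine (norm_sum_indicator_mul_le _ _ _ fun n _ => ?_).trans ?_
  · rw [norm_mul, norm_stdAddChar, mul_one]; exact norm_eFrac_le_one _ _
  · rw [card_filter_add_eq_zero, Nat.cast_one]
    exact add_le_add (norm_sum_range_eFrac_add_mul_twist_le c₂ l₂ h hch) le_rfl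

end Vanishing

end Polymath8a

end Literature.NumberTheory.Sieve
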